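import Summits.BirchSwinnertonDyer.Rank1Residual.Additive.KernelPolynomialRootValuation
import Summits.BirchSwinnertonDyer.Rank1Residual.Additive.GordRankZeroChiBranch
import Summits.BirchSwinnertonDyer.Rank1Residual.Additive.TwistModelPointEquivCoordinates
import Summits.BirchSwinnertonDyer.Rank1Residual.Additive.ChiBranchLowerAscent
import Summits.BirchSwinnertonDyer.Rank1Residual.Partition.EisensteinKernelReductionLine
import Summits.BirchSwinnertonDyer.Rank1Residual.Additive.RationalLineRamifiedOfTwist
import HarnessLib

/-!
# The `χ_{p*}`-twist of the rational `p`-line of a kernel polynomial `h` is RAMIFIED at `p` — the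
# binder `hram` of the X3♯(G-ord, `e = 2`) end states — read off the `p`-adic valuations of the
# coefficients of `h` (cell `bsd-addord`, seat `bsd-addord-twist`; File C of the Φ₀ kernel records)

HONEST FRAMING (cell `bsd-addord`, `run/shared/lean/pub/bsd-addord/README.md` §4): the programme's
target of record is the full Birch–Swinnerton-Dyer formula for every `E/ℚ` of analytic rank `≤ 1`;
this is a TOOL file (twist transport of a rational line + valuation arithmetic; theorems only, no
definition, no named fact, no `sorry`). It books nothing.

## What

The fourth column of the per-pair line datum `CaseOneDatum W p` (`Additive/X3CaseOneMember.lean`) at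
`p ≥ 5` is
`hram : ∀ K quadratic ∋ θ, θ² = p*, ¬ (every inertia group above p acts on Φ₀ through χ_K)`,
i.e. the character of `Φ₀ ⊗ χ_{p*}` is ramified at `p`; on a twist model `C • V^{(p*)} = W` (`V`
good ordinary at `p`) it says that `Φ₀` is carried to the CANONICAL subgroup of `V[p]` (the kernel of
reduction), whose abscissas are not `p`-integral. The engines certify it by the `p`-adic valuations
of the kernel polynomial `h` of `Φ₀` on `W` (`HOME/proof/phi0-p5/README.md`: «v_p(h_d) = d − 1 with
one Newton slope»). THEOREM **`hram_of_twist_model_of_kernelPolyCert`**: if `Φ₀` is a rational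
`p`-line every non-zero point of which has abscissa a root of the MONIC `h ∈ ℤ[X]` of degree
`m = (p−1)/2 ≥ 2` with `p^{m−k} ∣ c_k` (`0 < k < m`) and `c₀ = p^{m−1}·a`, `p ∤ a`, then `hram`
holds. Proof: assume inertia acts on `Φ₀` through `χ_K`; transport `Φ₀` along
`E(ℚ̄) ≃ V^{(p*)}(ℚ̄) ≃ V(ℚ̄)` (`Additive/TwistModelPointEquivCoordinates.lean`: the tree's
`pointEquivBaseChange` for `C` and additive-p1's `twistGeomEquiv`, `Gal(ℚ̄/K)`-equivariant and
ANTI-equivariant off `Gal(ℚ̄/K)`, with its abscissa relation): the image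
`Φ_V ≤ V[p]` is a rational line FIXED by every inertia group above `p`, so by the good-ordinary
dichotomy (`KernelDisc.lineUnramifiedAt_iff_valuation_le_one`) its abscissas `x_V` are integral at
the place `𝔓 = placeOver p`; but `x_W = u⁻²(p*·x₁ − r)` with `x₁ = u₂⁻²(x_V − r₂)` (the two changes
of variables; `|u⁻¹|, |r u⁻²|, |u₂⁻¹|, |r₂ u₂⁻²| ≤ 1` by `Δ(C • X) = u⁻¹²Δ(X)`, `Δ(V^{(d)}) = d⁶Δ(V)`,
`b₂(C • X) = u⁻²(b₂ + 12r)`, File `KernelPolynomialRootValuation`), so `|x_W| = 1` or `|x_W| ≤ |p|`,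
contradicting `|p| < |x_W| < 1` for a root of a generalised-Eisenstein `h`
(`KernelPolyLine.lt_val_root`, `val_root_lt_one`). Class form: **`ClassX3Gord.hram_of_kernelPolyCert`**
(the twist model from `ClassX3Gord.exists_goodOrd_pStar_twist_model`).

References: R. Greenberg, V. Vatsal, Invent. Math. 142 (2000) §2 p. 28 (Case 1) [GreenbergVatsal2000];
J.-P. Serre, Invent. Math. 15 (1972) §1.11 (canonical subgroup) [Serre1972]; J. H. Silverman, *AEC*
2nd ed., III.1 Table 3.1, VII.1.3(d), VII.2.1, X.5 Cor. 5.4 [SilvermanAEC2009];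
HOME/proof/phi0-p5/README.md (dictionary `hram`).
-/

set_option autoImplicit false

noncomputable section

open scoped Classical NumberField

open WeierstrassCurve Polynomial Literature.NumberTheory.EllipticCurves
  Literature.NumberTheory.EllipticCurves.Rank1Residual Literature.NumberTheory.GaloisRepresentations
  Field IsDedekindDomain NumberField
  Summit.BirchSwinnertonDyer.Rank1Residual.AdditivePotMult

namespace Summit.BirchSwinnertonDyer.Rank1Residual.Additive.KernelPolyLine

/-! ## §2 Integrality bookkeeping at the place over `p` -/

section Integrality

variable (p : ℕ) [hp : Fact p.Prime]

/-- A globally minimal equation has `p`-integral `b₂`. [folklore] -/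
theorem val_b₂_le_one (X : WeierstrassCurve ℚ) [X.IsGloballyMinimal] :
    (placeOver p).valuation (algebraMap ℚ (AlgebraicClosure ℚ) X.b₂) ≤ 1 := by
  have h : X.b₂ = ((integralModelInt X).b₂ : ℚ) := by
    have e := congrArg WeierstrassCurve.b₂ (map_integralModelInt X)
    rw [map_b₂, eq_intCast] at e
    exact e.symm
  rw [h, map_intCast]
  exact val_intCast_le_one p _

/-- A globally minimal equation has `p`-integral discriminant. [folklore] -/
theorem val_Δ_le_one (X : WeierstrassCurve ℚ) [X.IsGloballyMinimal] :
    (placeOver p).valuation (algebraMap ℚ (AlgebraicClosure ℚ) X.Δ) ≤ 1 := by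
  rw [← cast_minimalDiscriminantInt X, map_intCast]
  exact val_intCast_le_one p _

/-- At a prime of good reduction the minimal discriminant is a unit: `|Δ| = 1`. [folklore] -/
theorem val_Δ_eq_one_of_good (X : WeierstrassCurve ℚ) [X.IsGloballyMinimal]
    (hgood : X.HasGoodReductionAtPrime p) :
    (placeOver p).valuation (algebraMap ℚ (AlgebraicClosure ℚ) X.Δ) = 1 := by
  rw [← cast_minimalDiscriminantInt X, map_intCast]
  exact valuation_placeOver_intCast_eq_one p
    (not_dvd_minimalDiscriminantInt_of_hasGoodReductionAtPrime' X p hgood)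

/-- `|p*| = |p|`. [folklore] -/
theorem val_pStar_eq : (placeOver p).valuation (algebraMap ℚ (AlgebraicClosure ℚ) ((-1) ^ (p / 2) * p)) =
    (placeOver p).valuation ((p : ℕ) : AlgebraicClosure ℚ) := by
  rw [map_mul, map_pow, map_neg, map_one, map_natCast, Valuation.map_mul, Valuation.map_pow,
    Valuation.map_neg, Valuation.map_one, one_pow, one_mul]

/-- In the value group: `w¹² = 1 ⇒ w = 1`. [folklore] -/
theorem eq_one_of_pow_twelve_eq_one {Γ₀ : Type*} [LinearOrderedCommGroupWithZero Γ₀] {w : Γ₀}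
    (h : w ^ 12 = 1) : w = 1 := by
  rcases lt_trichotomy w 1 with hlt | heq | hgt
  · exact absurd h (pow_lt_one₀ zero_le hlt (by norm_num)).ne
  · exact heq
  · exact absurd h (one_lt_pow₀ hgt (by norm_num)).ne'

/-- **The completed square `sqChange V`** (`sqChange V • V = V^{(1)}`): `|u₂⁻¹| = 1` and `|r₂| ≤ 1`
at every `p ≥ 5`, for `V` globally minimal (`Δ(V^{(1)}) = Δ(V)`, `b₂(V^{(1)}) = b₂(V)`). [folklore] -/
theorem val_sqChange (hp5 : 5 ≤ p) (V : WeierstrassCurve ℚ) [V.IsElliptic] [V.IsGloballyMinimal] :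
    (placeOver p).valuation (algebraMap ℚ (AlgebraicClosure ℚ) (((sqChange V).u⁻¹ : ℚˣ) : ℚ)) = 1 ∧
      (placeOver p).valuation (algebraMap ℚ (AlgebraicClosure ℚ) (sqChange V).r) ≤ 1 := by
  have hspec : sqChange V • V = V.quadraticTwist 1 := sqChange_spec V
  -- `u₂⁻¹ ^ 12 = 1`
  have hΔ : (V.quadraticTwist 1).Δ = V.Δ := by rw [quadraticTwist_Δ, one_pow, one_mul]
  have hΔ' : (sqChange V • V).Δ = (((sqChange V).u⁻¹ : ℚˣ) : ℚ) ^ 12 * V.Δ := variableChange_Δ V _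
  rw [hspec, hΔ] at hΔ'
  have hΔ0 : V.Δ ≠ 0 := V.Δ'.ne_zero
  have hu12 : (((sqChange V).u⁻¹ : ℚˣ) : ℚ) ^ 12 = 1 := by
    have := hΔ'.symm
    rwa [mul_left_eq_self₀, or_iff_left hΔ0] at this
  have hu : (placeOver p).valuation (algebraMap ℚ (AlgebraicClosure ℚ) (((sqChange V).u⁻¹ : ℚˣ) : ℚ)) = 1 := by
    apply eq_one_of_pow_twelve_eq_one
    rw [← Valuation.map_pow, ← map_pow, hu12, map_one, Valuation.map_one]
  refine ⟨hu, ?_⟩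
  have hY : (placeOver p).valuation (algebraMap ℚ (AlgebraicClosure ℚ) (V.quadraticTwist 1).b₂) ≤ 1 := by
    rw [quadraticTwist_b₂, one_mul]; exact val_b₂_le_one p V
  have hr := val_r_mul_le_one_of_b₂ p hp5 hspec (val_b₂_le_one p V) hY hu.le
  rw [map_mul, map_pow, Valuation.map_mul, Valuation.map_pow, hu, one_pow, mul_one] at hr
  exact hr

/-- **The twist-model change `C`** (`C • V^{(p*)} = W`, `V` good at `p`, both globally minimal,
`p ≥ 5`): `|u⁻¹| ≤ 1` (from `|Δ(W)| ≤ 1 = |Δ(V)|`, `Δ(V^{(p*)}) = p*⁶ Δ(V)`) and `|r u⁻²| ≤ 1`.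
[cite: SilvermanAEC2009, VII.1.3(d)] -/
theorem val_twistModelChange (hp5 : 5 ≤ p) {W V : WeierstrassCurve ℚ} [W.IsGloballyMinimal]
    [V.IsGloballyMinimal] (hgood : V.HasGoodReductionAtPrime p) {C : VariableChange ℚ}
    (hC : C • V.quadraticTwist ((-1) ^ (p / 2) * p) = W) :
    (placeOver p).valuation (algebraMap ℚ (AlgebraicClosure ℚ) ((C.u⁻¹ : ℚˣ) : ℚ)) ≤ 1 ∧
      (placeOver p).valuation (algebraMap ℚ (AlgebraicClosure ℚ) (C.r * ((C.u⁻¹ : ℚˣ) : ℚ) ^ 2)) ≤ 1 := by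
  have hΔ' : (C • V.quadraticTwist ((-1) ^ (p / 2) * p)).Δ =
      ((C.u⁻¹ : ℚˣ) : ℚ) ^ 12 * (((-1) ^ (p / 2) * p) ^ 6 * V.Δ) := by
    rw [variableChange_Δ, quadraticTwist_Δ]
  rw [hC] at hΔ'
  have hu : (placeOver p).valuation (algebraMap ℚ (AlgebraicClosure ℚ) ((C.u⁻¹ : ℚˣ) : ℚ)) ≤ 1 := by
    apply val_le_one_of_pow_twelve_mul_le p
    have h1 := val_Δ_le_one p W
    rw [hΔ'] at h1
    simp only [map_mul, map_pow] at h1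
    rw [map_neg, map_one, Valuation.map_neg, Valuation.map_one, one_pow, one_mul, map_natCast,
      val_Δ_eq_one_of_good p V hgood, mul_one] at h1
    exact h1
  refine ⟨hu, ?_⟩
  have hX : (placeOver p).valuation
      (algebraMap ℚ (AlgebraicClosure ℚ) (V.quadraticTwist ((-1) ^ (p / 2) * p)).b₂) ≤ 1 := by
    rw [quadraticTwist_b₂, map_mul, Valuation.map_mul, val_pStar_eq p]
    exact mul_le_one' (valuation_placeOver_natCast_lt_one p).le (val_b₂_le_one p V)
  exact val_r_mul_le_one_of_b₂ p hp5 hC hX (val_b₂_le_one p W) hu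

end Integrality

/-! ## §3 The theorem: `hram` from the kernel-polynomial certificate -/

section Main

variable {W : WeierstrassCurve ℚ} [W.IsElliptic] [W.IsGloballyMinimal] {p : ℕ} [hp : Fact p.Prime]

omit [W.IsElliptic] in
/-- **`hram` from a twist model and the valuation certificate of the kernel polynomial.** Let
`C • V^{(p*)} = W` with `V` globally minimal and GOOD ORDINARY at `p ≥ 5`, and let `Φ₀ ≤ E[p]` be a
rational `p`-line every non-zero point of which has abscissa a root of `h ∈ ℚ[X]`, `h` monic of
degree `m` (`2m + 1 = p`) with integer coefficients `c_k`, `p^{m−k} ∣ c_k` for `0 < k < m` and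
`c₀ = p^{m−1}·a`, `p ∤ a`. Then for every quadratic field `K ∋ θ`, `θ² = p*`, the inertia groups
above `p` do NOT act on `Φ₀` through the character of `K`: the `χ_{p*}`-twist of `Φ₀` is ramified at
`p` (it is the canonical subgroup of `V[p]`). [cite: GreenbergVatsal2000, §2 p. 28]
[cite: Serre1972, §1.11] [cite: SilvermanAEC2009, VII.2.1, X.5 Cor. 5.4] -/
theorem hram_of_twist_model_of_kernelPolyCert (hp5 : 5 ≤ p) {V : WeierstrassCurve ℚ} [V.IsElliptic]
    [V.IsGloballyMinimal] (hV : GoodOrd V p) {C : VariableChange ℚ}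
    (hC : C • V.quadraticTwist ((-1) ^ (p / 2) * p) = W)
    {h : ℚ[X]} {m : ℕ} (hm : 2 * m + 1 = p) (hmon : h.Monic) (hdegm : h.natDegree = m)
    (hcoef : ∀ k, 0 < k → k < m → ∃ c : ℤ, h.coeff k = (c : ℚ) ∧ (p : ℤ) ^ (m - k) ∣ c)
    (hzero : ∃ a : ℤ, h.coeff 0 = (p : ℚ) ^ (m - 1) * a ∧ ¬ (p : ℤ) ∣ a)
    {Φ₀ : AddSubgroup (geomTorsion W (p : ℤ))} (hΦ : IsRationalLine W p Φ₀)
    (habs : ∀ Q ∈ Φ₀, Q ≠ 0 → ∃ (x y : AlgebraicClosure ℚ)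
      (hxy : (W.baseChange (AlgebraicClosure ℚ)).toAffine.Nonsingular x y),
      (Q : W.geomPoints) = Affine.Point.some x y hxy ∧
        (h.map (algebraMap ℚ (AlgebraicClosure ℚ))).eval x = 0) :
    ∀ (K : Type) [Field K] [NumberField K] [(galRange (K := ℚ) K).Normal],
      Module.finrank ℚ K = 2 → (∃ θ : K, θ ^ 2 = algebraMap ℚ K ((-1) ^ (p / 2) * p)) →
      ¬ ∀ v : HeightOneSpectrum (𝓞 ℚ), ((p : ℕ) : 𝓞 ℚ) ∈ v.asIdeal →
        ∀ 𝔓 ∈ v.primesAbove, ∀ σ ∈ 𝔓.inertia (Field.absoluteGaloisGroup ℚ), ∀ P ∈ Φ₀,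
          σ • P = (if σ ∈ galRange (K := ℚ) K then P else -P) := by
  intro K _ _ _ hK2 hθ H
  obtain ⟨θ, hθ2⟩ := hθ
  have hpr : p.Prime := hp.out
  have hp2 : p ≠ 2 := by omega
  have hm2 : 2 ≤ m := by omega
  have hθnr : θ ∉ Set.range (algebraMap ℚ K) := not_mem_range_algebraMap_of_sq_eq_pStar hθ2
  obtain ⟨e, hpos, hneg, hcoord⟩ := exists_torsionEquiv_of_twist_model K hθnr hθ2 hC p hK2
  -- the transported line `Φ_V = e(Φ₀) ≤ V[p]`
  set ΦV : AddSubgroup (geomTorsion V (p : ℤ)) :=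
    Φ₀.map (e : geomTorsion W (p : ℤ) →+ geomTorsion V (p : ℤ)) with hΦV
  have hΦVrat : IsRationalLine V p ΦV := by
    refine ⟨?_, ?_⟩
    · rw [hΦV]
      exact (Nat.card_congr (e.addSubgroupMap Φ₀).toEquiv.symm).trans hΦ.1
    · intro σ S hS
      obtain ⟨T, hT, rfl⟩ := AddSubgroup.mem_map.mp hS
      by_cases hσ : σ ∈ galRange (K := ℚ) K
      · change σ • e T ∈ ΦV
        rw [← hpos σ hσ T]
        exact AddSubgroup.mem_map.mpr ⟨σ • T, hΦ.2 σ T hT, rfl⟩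
      · change σ • e T ∈ ΦV
        have h1 : σ • e T = e (-(σ • T)) := by
          rw [map_neg, hneg σ hσ T, neg_neg]
        rw [h1]
        exact AddSubgroup.mem_map.mpr ⟨-(σ • T), Φ₀.neg_mem (hΦ.2 σ T hT), rfl⟩
  -- ... which is UNRAMIFIED at `p` under the hypothesis `H`
  have hunr : LineUnramifiedAt V p ΦV := by
    intro v hv 𝔓 h𝔓 σ hσ S hS
    obtain ⟨T, hT, rfl⟩ := AddSubgroup.mem_map.mp hS
    have hT' := H v hv 𝔓 h𝔓 σ hσ T hT
    change σ • e T = e T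
    by_cases hg : σ ∈ galRange (K := ℚ) K
    · rw [if_pos hg] at hT'
      rw [← hpos σ hg T, hT']
    · rw [if_neg hg] at hT'
      have h1 : e (σ • T) = -(σ • e T) := hneg σ hg T
      rw [hT', map_neg, neg_inj] at h1
      exact h1.symm
  -- a point of `Φ₀`, its abscissa `α` (a root of `h`) and the abscissa `x_V` of its image
  obtain ⟨P, hPΦ, hP0⟩ := RationalLineTwist.exists_mem_ne_zero_of_isRationalLine hΦ
  obtain ⟨α, y, hxy, hPe, hα⟩ := habs P hPΦ hP0
  obtain ⟨xd, xV, yV, hV', heP, hx, hx1⟩ := hcoord P α y hxy hPe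
  have hePmem : e P ∈ ΦV := AddSubgroup.mem_map.mpr ⟨P, hPΦ, rfl⟩
  have heP0 : e P ≠ 0 := (AddEquiv.map_ne_zero_iff e).mpr hP0
  have hint : (placeOver p).valuation xV ≤ 1 :=
    (KernelDisc.lineUnramifiedAt_iff_valuation_le_one hΦVrat hp2 hV.1 hV.2 hePmem heP0 heP).mp hunr
  -- valuation bookkeeping
  set v := (placeOver p).valuation with hvdef
  set π := v ((p : ℕ) : AlgebraicClosure ℚ) with hπdef
  have hπ1 : π < 1 := valuation_placeOver_natCast_lt_one p
  obtain ⟨hu2, hr2⟩ := val_sqChange p hp5 V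
  obtain ⟨hu, hru⟩ := val_twistModelChange p hp5 hV.1 hC
  have htc : rootInClosure K θ ^ 2 = algebraMap ℚ (AlgebraicClosure ℚ) ((-1) ^ (p / 2) * p) :=
    rootInClosure_sq K hθ2
  have ht0 : rootInClosure K θ ≠ 0 := by
    intro h0
    rw [h0, zero_pow two_ne_zero] at htc
    exact (pStar_ne_zero p) ((algebraMap ℚ (AlgebraicClosure ℚ)).injective (by rw [map_zero]; exact htc)).symm
  -- `|x_d| ≤ π`
  have hxd : xd = rootInClosure K θ ^ 2 *
      (algebraMap ℚ (AlgebraicClosure ℚ) (((sqChange V).u⁻¹ : ℚˣ) : ℚ) ^ 2 *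
        (xV - algebraMap ℚ (AlgebraicClosure ℚ) (sqChange V).r)) := by
    rw [hx1, ← mul_assoc, ← mul_pow, mul_inv_cancel₀ ht0, one_pow, one_mul]
  have hvxd : v xd ≤ π := by
    rw [hxd, Valuation.map_mul, Valuation.map_pow, ← Valuation.map_pow, htc, val_pStar_eq p,
      Valuation.map_mul, Valuation.map_pow, hu2, one_pow, one_mul]
    refine mul_le_of_le_one_right' ?_
    exact Valuation.map_sub_le _ hint hr2
  -- `α = A − B`, `|A| ≤ π`, `B` rational with `|B| ≤ 1`
  have hαeq : α = algebraMap ℚ (AlgebraicClosure ℚ) ((C.u⁻¹ : ℚˣ) : ℚ) ^ 2 * xd -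
      algebraMap ℚ (AlgebraicClosure ℚ) (C.r * ((C.u⁻¹ : ℚˣ) : ℚ) ^ 2) := by
    rw [hx, map_mul, map_pow]; ring
  have hvA : v (algebraMap ℚ (AlgebraicClosure ℚ) ((C.u⁻¹ : ℚˣ) : ℚ) ^ 2 * xd) ≤ π := by
    rw [Valuation.map_mul, Valuation.map_pow]
    calc v (algebraMap ℚ (AlgebraicClosure ℚ) ((C.u⁻¹ : ℚˣ) : ℚ)) ^ 2 * v xd ≤ 1 * π :=
          mul_le_mul' (pow_le_one₀ zero_le hu) hvxd
      _ = π := one_mul π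
  -- the roots of `h` have `π < |α| < 1`
  have hcoef' : ∀ k, k < m → ∃ c : ℤ, h.coeff k = (c : ℚ) ∧ (p : ℤ) ∣ c := by
    intro k hk
    rcases Nat.eq_zero_or_pos k with rfl | hk0
    · obtain ⟨a, ha, -⟩ := hzero
      refine ⟨(p : ℤ) ^ (m - 1) * a, by rw [ha]; push_cast; ring, ?_⟩
      exact dvd_mul_of_dvd_left (dvd_pow_self _ (by omega)) a
    · obtain ⟨c, hc, hdvd⟩ := hcoef k hk0 hk
      exact ⟨c, hc, (dvd_pow_self _ (by omega)).trans hdvd⟩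
  have hlt1 : v α < 1 := val_root_lt_one p hmon hdegm hcoef' hα
  have hgt : π < v α := lt_val_root p hmon hdegm hm2 hcoef hzero hα
  -- dichotomy on the rational `B = r u⁻²`
  rcases val_ratCast_eq_one_or_le p _ hru with hB1 | hBle
  · -- `|B| = 1 > |A|`: `|α| = 1`
    have : v α = 1 := by
      rw [hαeq, sub_eq_add_neg, Valuation.map_add_eq_of_lt_right, Valuation.map_neg, hB1]
      rw [Valuation.map_neg, hB1]
      exact lt_of_le_of_lt hvA hπ1
    exact absurd this hlt1.ne
  · -- `|B| ≤ π`: `|α| ≤ π`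
    have : v α ≤ π := by
      rw [hαeq]
      exact Valuation.map_sub_le _ hvA hBle
    exact absurd hgt (not_lt.mpr this)

/-- **X3♯(G-ord) ∩ `I₀*` at `p ≥ 5`: `hram` from the kernel-polynomial certificate** — the twist
model is the cell's `ClassX3Gord.exists_goodOrd_pStar_twist_model`. With the keystone
(`exists_isRationalLine_of_kernelPolyCert`), the trace certificate (`lineEven_of_traceCert_pos`) and
`ClassX3Gord.not_lineUnramifiedAt` this gives `CaseOneDatum W p` from finitely many polynomial
identities and integer divisibilities. [cite: GreenbergVatsal2000, §2 p. 28] -/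
theorem ClassX3Gord.hram_of_kernelPolyCert (hX : ClassX3Gord W p) (hp5 : 5 ≤ p)
    (he : semistabilityIndex W p = 2)
    {h : ℚ[X]} {m : ℕ} (hm : 2 * m + 1 = p) (hmon : h.Monic) (hdegm : h.natDegree = m)
    (hcoef : ∀ k, 0 < k → k < m → ∃ c : ℤ, h.coeff k = (c : ℚ) ∧ (p : ℤ) ^ (m - k) ∣ c)
    (hzero : ∃ a : ℤ, h.coeff 0 = (p : ℚ) ^ (m - 1) * a ∧ ¬ (p : ℤ) ∣ a)
    {Φ₀ : AddSubgroup (geomTorsion W (p : ℤ))} (hΦ : IsRationalLine W p Φ₀)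
    (habs : ∀ Q ∈ Φ₀, Q ≠ 0 → ∃ (x y : AlgebraicClosure ℚ)
      (hxy : (W.baseChange (AlgebraicClosure ℚ)).toAffine.Nonsingular x y),
      (Q : W.geomPoints) = Affine.Point.some x y hxy ∧
        (h.map (algebraMap ℚ (AlgebraicClosure ℚ))).eval x = 0) :
    ∀ (K : Type) [Field K] [NumberField K] [(galRange (K := ℚ) K).Normal],
      Module.finrank ℚ K = 2 → (∃ θ : K, θ ^ 2 = algebraMap ℚ K ((-1) ^ (p / 2) * p)) →
      ¬ ∀ v : HeightOneSpectrum (𝓞 ℚ), ((p : ℕ) : 𝓞 ℚ) ∈ v.asIdeal →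
        ∀ 𝔓 ∈ v.primesAbove, ∀ σ ∈ 𝔓.inertia (Field.absoluteGaloisGroup ℚ), ∀ P ∈ Φ₀,
          σ • P = (if σ ∈ galRange (K := ℚ) K then P else -P) := by
  have hp2 : p ≠ 2 := by have := hp.out.two_le; omega
  obtain ⟨V, iV, iVm, C, hV, hC⟩ := ClassX3Gord.exists_goodOrd_pStar_twist_model W p hp2 hX he
  exact hram_of_twist_model_of_kernelPolyCert hp5 hV hC hm hmon hdegm hcoef hzero hΦ habs

end Main

end Summit.BirchSwinnertonDyer.Rank1Residual.Additive.KernelPolyLine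

end
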